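import Summits.QuantumAdvantage.QuantumAdvantage.Theorems.AnchorDialGauge

/-!
# AnchorDial — part 21 «Multi» (cell decomp-qadv, seat lens-2, generation 15; supports item 26531 `ExactnessDial.PolyLossOddU3`)

§D of the g15 node «GaugeDial», re-namespaced to `…Theorems.AnchorDial`: the MULTI-ANCHOR cut.  `MAnchorable m r c P`
(`m` declarable anchor families of degree `≤ (log₂ N)^c`, a.e. unique and flip-stable on average with VANISHING
exceptional masses `≤ 2^{N-1}/log₂ N`, confining the deviation set `dev P x` a.e. to the union of their `m` windows of
width `r`), the pieces `MultiAnchorLoss3` (W) and `NoMultiAnchorLoss3` (R), the dichotomy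
`polyLossOddU3_of_dichotomy : W → R → T`, the restrictions `multiAnchorLoss3_of_polyLossOddU3`,
`noMultiAnchorLoss3_of_polyLossOddU3`, the node equation `polyLossOddU3_iff_multiAnchor : T ⟺ W ∧ R`, the assembly
`closes_multiAnchor : W → R → DPLift3 → AdviceFreeQNC0Three` (via `HolonomyDial.closes_T`), the `m = 1` slice
(`sAnchorable_of_mAnchorable_one`, `multiAnchor_one_loss`, `multiAnchorLoss3_slice_one` = the landed `windowSet_loss`),
`noSetAnchorLoss3_of_noMultiAnchorLoss3` (R refines g14's residual) and monotonicity in `m` (`mAnchorable_succ`,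
`mAnchorable_mono_m`).  Namespace `…Theorems.AnchorDial`; imports part 20 (landed).  Verbatim from the node file §D up to
the namespace and the two renames (`closes` ↦ `closes_multiAnchor`, `node_iff` ↦ `polyLossOddU3_iff_multiAnchor`); no `sorry`, no `native_decide`, no instances/notation; lint-clean without the unusedVariables switch.
-/

set_option linter.dupNamespace false

/-! ## §D  THE NODE: `T ⟺ MultiAnchorLoss3 ∧ NoMultiAnchorLoss3` (special = multi-anchorable, generic = the rest) -/

noncomputable section

open scoped Classical

namespace Summit.QuantumAdvantage.QuantumAdvantage.Theorems.AnchorDial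

set_option exponentiation.threshold 4100

open Finset
open Literature.Computability.QuantumComplexity Literature.Computability.QuantumComplexity.RingHLF
open Literature.Computability.MetaComplexity Literature.Computability.MetaComplexity.Smolensky
open Summit.QuantumAdvantage.AdviceFreeQNC0
open Summit.QuantumAdvantage.QuantumAdvantage.Theses (ExactnessDial.PolyLossOddU3 ExactnessDial.DPLift3)
open Summit.QuantumAdvantage.QuantumAdvantage.Theorems.HolonomyDial (closes_T card_odd_le)

variable {N : ℕ}

/-- **`m`-ANCHORABLE** at width `r`, degree budget `(log₂ N)^c`: there are `m` declared ANCHOR FAMILIES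
`A_j : Fin N → CubeFn`, each of degree `≤ (log₂ N)^c`, each a.e. UNIQUE (UNIQ) and FLIP-STABLE on average (STAB) —
exceptional masses `≤ 2^{N-1}/log₂ N`, i.e. VANISHING — such that, for all but `2^{N-1}/log₂ N` odd inputs, some
choice of declared anchors `k_j ∈ anc A_j x` has the whole deviation set inside `⋃_j [k_j, k_j + r]` (NEAR).
`m = 1` with threshold `4096` is g14's `SAnchorable` (`sAnchorable_of_mAnchorable_one`). -/
def MAnchorable (m r c : ℕ) (P : Fin N → CubeFn (ZMod 3) N) : Prop :=
  ∃ A : Fin m → Fin N → CubeFn (ZMod 3) N,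
    (∀ j k, A j k ∈ lowDeg (ZMod 3) N ((Nat.log 2 N) ^ c)) ∧
    (∀ j, Nat.log 2 N * (univ.filter fun x : Fin N → Bool =>
        OddZeros x ∧ (univ.filter fun k : Fin N => A j k x = 1).card ≠ 1).card ≤ 2 ^ (N - 1)) ∧
    (∀ j, Nat.log 2 N * (∑ a ∈ range N, (univ.filter fun x : Fin N → Bool =>
        OddZeros x ∧ ∃ k : Fin N, ¬ ((A j k (flip2 a (a + 1) x) = 1) ↔ (A j k x = 1))).card) ≤
        N * 2 ^ (N - 1)) ∧
    Nat.log 2 N * (univ.filter fun x : Fin N → Bool => OddZeros x ∧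
        ¬ ∃ kv : Fin m → Fin N, (∀ j, A j (kv j) x = 1) ∧
          ∀ i ∈ dev P x, ∃ j, (kv j).val ≤ i.val ∧ i.val ≤ (kv j).val + r).card ≤ 2 ^ (N - 1)

/-- **PIECE W (crux) `MultiAnchorLoss3` — `T` RESTRICTED TO MULTI-ANCHORABLE STRATEGIES**: for every number of
anchors `m`, width `r` and degree budget `c`, every degree-`(log₂ n)^c` strategy that is `m`-anchorable loses a
polynomial fraction of the odd class.  NECESSARY (restriction of `T`, `multiAnchorLoss3_of_polyLossOddU3`);
WEAKER (a class condition); ATTACKABLE: the `m = 1` slice is the tree's SET-WINDOW LAW (`multiAnchorLoss3_slice_one`,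
PROVED, exponent `1`), and for general `m` the combinatorial engine is PROVED in this file — the `F`-flip core
`CoreF.card_compatF_le`, the gauge-reduction orbit law `gauge_orbit_avoids` and the gauge union bound
`card_gauge_compat_le` (`6^m·(1+F+C(F,2)) < 2^F`); what remains is the `F`-site counting shell (instability, datum,
`F+1`-block equidistribution `chainF`, placement in one inter-window region) — INSTRUMENTABLE, no new idea. -/
def MultiAnchorLoss3 : Prop :=
  ∃ C : ℕ, ∀ m r c : ℕ, ∃ n₀ : ℕ, ∀ n ≥ n₀, ∀ P : Fin n → CubeFn (ZMod 3) n,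
    (∀ i, P i ∈ lowDeg (ZMod 3) n ((Nat.log 2 n) ^ c)) → MAnchorable m r c P →
      ((univ.filter fun x : Fin n → Bool => OddZeros x ∧ Rel x (fun i => decide (P i x = 1))).card : ℝ) ≤
        (1 - 1 / (n : ℝ) ^ C) * (2 : ℝ) ^ (n - 1)

/-- **PIECE R (typed residual) `NoMultiAnchorLoss3` — `T` RESTRICTED TO BOUNDEDLY-DELOCALISED STRATEGIES**: those
admitting, for the given `m, r, c`, NO system of `m` declarable (polylog, a.e.-unique, flip-stable) coarse anchors
confining the deviation set to `m` windows of width `r`, a.e.  `≡ T` modulo `W` (`polyLossOddU3_iff_multiAnchor`); contained in g14's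
residual (`noSetAnchorLoss3_of_noMultiAnchorLoss3`).  IDEA-NEEDED; BARRIER-ADJACENT (relative Smolensky / small-set
expansion: a near-perfect polylog strategy must spread its bet over UNBOUNDEDLY MANY undeclarable locations). -/
def NoMultiAnchorLoss3 : Prop :=
  ∃ C : ℕ, ∀ m r c : ℕ, ∃ n₀ : ℕ, ∀ n ≥ n₀, ∀ P : Fin n → CubeFn (ZMod 3) n,
    (∀ i, P i ∈ lowDeg (ZMod 3) n ((Nat.log 2 n) ^ c)) → ¬ MAnchorable m r c P →
      ((univ.filter fun x : Fin n → Bool => OddZeros x ∧ Rel x (fun i => decide (P i x = 1))).card : ℝ) ≤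
        (1 - 1 / (n : ℝ) ^ C) * (2 : ℝ) ^ (n - 1)

/-- `T → W` (restriction). -/
theorem multiAnchorLoss3_of_polyLossOddU3 (h : ExactnessDial.PolyLossOddU3) : MultiAnchorLoss3 := by
  obtain ⟨C, hC⟩ := h
  refine ⟨C, fun _ _ c => ?_⟩
  obtain ⟨n₀, hn₀⟩ := hC c
  exact ⟨n₀, fun n hn P hP _ => hn₀ n hn P hP⟩

/-- `T → R` (restriction). -/
theorem noMultiAnchorLoss3_of_polyLossOddU3 (h : ExactnessDial.PolyLossOddU3) : NoMultiAnchorLoss3 := by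
  obtain ⟨C, hC⟩ := h
  refine ⟨C, fun _ _ c => ?_⟩
  obtain ⟨n₀, hn₀⟩ := hC c
  exact ⟨n₀, fun n hn P hP _ => hn₀ n hn P hP⟩

/-- **dichotomy `W ∧ R → T`**: at degree budget `c` split on `MAnchorable c c c` (any diagonal exhausting all
`(m, r)` works; the classes grow with `m` and `r`). -/
theorem polyLossOddU3_of_dichotomy (hW : MultiAnchorLoss3) (hR : NoMultiAnchorLoss3) :
    ExactnessDial.PolyLossOddU3 := by
  obtain ⟨CW, hW⟩ := hW
  obtain ⟨CR, hR⟩ := hR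
  refine ⟨max CW CR, fun c => ?_⟩
  obtain ⟨n₁, hn₁⟩ := hW c c c
  obtain ⟨n₂, hn₂⟩ := hR c c c
  refine ⟨max (max n₁ n₂) 1, fun n hn P hP => ?_⟩
  have hn1 : n₁ ≤ n := le_trans (le_trans (le_max_left _ _) (le_max_left _ _)) hn
  have hn2 : n₂ ≤ n := le_trans (le_trans (le_max_right _ _) (le_max_left _ _)) hn
  have h1 : 1 ≤ n := le_trans (le_max_right _ _) hn
  have hP0 : (0 : ℝ) ≤ (2 : ℝ) ^ (n - 1) := by positivity
  by_cases hc : MAnchorable c c c P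
  · exact loss_shape_mono h1 (le_max_left CW CR) _ _ hP0 (hn₁ n hn1 P hP hc)
  · exact loss_shape_mono h1 (le_max_right CW CR) _ _ hP0 (hn₂ n hn2 P hP hc)

/-- **NODE EQUATION**: `T ⟺ W ∧ R`. -/
theorem polyLossOddU3_iff_multiAnchor : ExactnessDial.PolyLossOddU3 ↔ MultiAnchorLoss3 ∧ NoMultiAnchorLoss3 :=
  ⟨fun h => ⟨multiAnchorLoss3_of_polyLossOddU3 h, noMultiAnchorLoss3_of_polyLossOddU3 h⟩,
    fun h => polyLossOddU3_of_dichotomy h.1 h.2⟩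

/-- **`closes`**: the pieces reach the leaf `AdviceFreeQNC0Three` BY NAME through the tree's `HolonomyDial.closes_T`
(with the cone's outer lift `DPLift3`, the standing hypothesis of every node of this lineage). -/
theorem closes_multiAnchor (hW : MultiAnchorLoss3) (hR : NoMultiAnchorLoss3) (hD : ExactnessDial.DPLift3) :
    AdviceFreeQNC0Three :=
  closes_T (polyLossOddU3_of_dichotomy hW hR) hD

/-! ### the `m = 1` slice of W is the tree's set-window law; the residual refines g14's -/

/-- one anchor family with vanishing exceptional mass is g14-anchorable (threshold `4096`) once `log₂ N ≥ 4096`. -/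
theorem sAnchorable_of_mAnchorable_one {r c : ℕ} (hN : 2 ^ 4096 ≤ N) {P : Fin N → CubeFn (ZMod 3) N}
    (h : MAnchorable 1 r c P) : SAnchorable r c P := by
  obtain ⟨A, hA, hU, hS, hNr⟩ := h
  have hL : 4096 ≤ Nat.log 2 N := Nat.le_log_of_pow_le (by norm_num) hN
  refine ⟨A 0, hA 0, le_trans (Nat.mul_le_mul_right _ hL) (hU 0), le_trans (Nat.mul_le_mul_right _ hL) (hS 0),
    le_trans (Nat.mul_le_mul_right _ hL) (le_trans (Nat.mul_le_mul_left _ (card_le_card fun x hx => ?_)) hNr)⟩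
  rw [mem_filter] at hx ⊢
  refine ⟨hx.1, hx.2.1, fun ⟨kv, hkv, hnear⟩ => hx.2.2 ⟨kv 0, hkv 0, fun i hi => ?_⟩⟩
  obtain ⟨j, hj⟩ := hnear i hi
  have hj0 : j = 0 := Subsingleton.elim _ _
  subst hj0
  exact hj

/-- conversely g14-anchorable is `1`-anchorable once `log₂ N ≤ 4096`-free: for ALL `N` with `Nat.log 2 N ≤ 4096` the
implication is the other way; we record the direction the node needs (`MAnchorable 1 → SAnchorable`) and the law. -/
theorem multiAnchor_one_loss (r c : ℕ) : ∃ n₀ : ℕ, ∀ n ≥ n₀, ∀ P : Fin n → CubeFn (ZMod 3) n,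
    (∀ i, P i ∈ lowDeg (ZMod 3) n ((Nat.log 2 n) ^ c)) → MAnchorable 1 r c P →
      2 ^ (n - 1) ≤ 49 * (univ.filter fun x : Fin n → Bool =>
        OddZeros x ∧ ¬ Rel x (fun i => decide (P i x = 1))).card := by
  obtain ⟨n₀, hn₀⟩ := windowSet_loss r c
  refine ⟨max n₀ (2 ^ 4096), fun n hn P hP hM => ?_⟩
  obtain ⟨A, hA, hU, hS, hN⟩ := sAnchorable_of_mAnchorable_one (le_trans (le_max_right _ _) hn) hM
  exact hn₀ n (le_trans (le_max_left _ _) hn) P A hP hA hU hS hN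

/-- **the `m = 1` slice of `MultiAnchorLoss3`, PROVED** (exponent `1`; from the tree's `windowSet_loss`). -/
theorem multiAnchorLoss3_slice_one (r c : ℕ) : ∃ n₀ : ℕ, ∀ n ≥ n₀, ∀ P : Fin n → CubeFn (ZMod 3) n,
    (∀ i, P i ∈ lowDeg (ZMod 3) n ((Nat.log 2 n) ^ c)) → MAnchorable 1 r c P →
      ((univ.filter fun x : Fin n → Bool => OddZeros x ∧ Rel x (fun i => decide (P i x = 1))).card : ℝ) ≤
        (1 - 1 / (n : ℝ) ^ 1) * (2 : ℝ) ^ (n - 1) := by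
  obtain ⟨n₂, hn₂⟩ := multiAnchor_one_loss r c
  refine ⟨max n₂ 49, fun n hn P hP hM => ?_⟩
  have hn2 : n₂ ≤ n := le_trans (le_max_left _ _) hn
  have hn49 : 49 ≤ n := le_trans (le_max_right _ _) hn
  have hL := hn₂ n hn2 P hP hM
  have hWL := Finset.card_filter_add_card_filter_not
    (s := (univ : Finset (Fin n → Bool)).filter fun x => OddZeros x)
    (fun x => Rel x (fun i => decide (P i x = 1)))
  rw [filter_filter, filter_filter] at hWL
  have hO' := card_odd_le (n := n) (by omega)
  have h48 : 49 * (univ.filter fun x : Fin n → Bool =>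
      OddZeros x ∧ Rel x (fun i => decide (P i x = 1))).card ≤ 48 * 2 ^ (n - 1) := by omega
  have hfin : n * (univ.filter fun x : Fin n → Bool =>
      OddZeros x ∧ Rel x (fun i => decide (P i x = 1))).card + 2 ^ (n - 1) ≤ n * 2 ^ (n - 1) := by
    have h1 := Nat.mul_le_mul_left n h48
    rw [Nat.mul_left_comm n 49, Nat.mul_left_comm n 48] at h1
    have h2 := Nat.mul_le_mul_right (2 ^ (n - 1)) hn49
    omega
  have hreal := real_tail n _ (2 ^ (n - 1)) (by omega) hfin
  push_cast at hreal
  exact hreal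

/-- the rev-15 residual class is contained in g14's: `R → NoSetAnchorLoss3` (both `≡ T`). -/
theorem noSetAnchorLoss3_of_noMultiAnchorLoss3 (h : NoMultiAnchorLoss3) : NoSetAnchorLoss3 := by
  obtain ⟨C, hC⟩ := h
  refine ⟨C, fun c r => ?_⟩
  obtain ⟨n₀, hn₀⟩ := hC 1 r c
  exact ⟨max n₀ (2 ^ 4096), fun n hn P hP hns => hn₀ n (le_trans (le_max_left _ _) hn) P hP fun hm =>
    hns (sAnchorable_of_mAnchorable_one (le_trans (le_max_right _ _) hn) hm)⟩

/-- the special classes are NESTED in `m`: a dummy constant anchor family can always be added. -/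
theorem mAnchorable_succ (hN : 1 ≤ N) {m r c : ℕ} {P : Fin N → CubeFn (ZMod 3) N} (h : MAnchorable m r c P) :
    MAnchorable (m + 1) r c P := by
  obtain ⟨A, hA, hU, hS, hNr⟩ := h
  set D : Fin N → CubeFn (ZMod 3) N := fun k => if k.val = 0 then 1 else 0 with hD
  have hD1 : ∀ (k : Fin N) (x : Fin N → Bool), D k x = 1 ↔ k.val = 0 := by
    intro k x
    by_cases hk : k.val = 0
    · simp [hD, hk]
    · simp [hD, hk]
  set A' : Fin (m + 1) → Fin N → CubeFn (ZMod 3) N := Fin.cons D A with hA'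
  have hA'0 : A' 0 = D := by rw [hA']; exact Fin.cons_zero _ _
  have hA's : ∀ j : Fin m, A' j.succ = A j := fun j => by rw [hA']; exact Fin.cons_succ _ _ _
  refine ⟨A', ?_, ?_, ?_, ?_⟩
  · intro j k
    refine Fin.cases ?_ (fun j => ?_) j
    · rw [hA'0]
      by_cases hk : k.val = 0
      · simp only [hD, hk, if_true]; exact one_mem_lowDeg _
      · simp only [hD, hk, if_false]; exact Submodule.zero_mem _
    · rw [hA's]; exact hA j k
  · intro j
    refine Fin.cases ?_ (fun j => ?_) j
    · have e : (univ.filter fun x : Fin N → Bool => OddZeros x ∧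
          (univ.filter fun k : Fin N => A' 0 k x = 1).card ≠ 1) = ∅ := by
        refine filter_eq_empty_iff.2 fun x _ h => h.2 ?_
        have : (univ.filter fun k : Fin N => A' 0 k x = 1) = {⟨0, by omega⟩} := by
          ext k
          rw [mem_filter, mem_singleton, hA'0, hD1, Fin.ext_iff]
          simp
        rw [this, card_singleton]
      rw [e, card_empty, mul_zero]
      exact Nat.zero_le _
    · simp only [hA's]; exact hU j
  · intro j
    refine Fin.cases ?_ (fun j => ?_) j
    · have e : ∀ a : ℕ, (univ.filter fun x : Fin N → Bool => OddZeros x ∧ ∃ k : Fin N,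
          ¬ ((A' 0 k (flip2 a (a + 1) x) = 1) ↔ (A' 0 k x = 1))) = ∅ := fun a => by
        refine filter_eq_empty_iff.2 fun x _ h => ?_
        obtain ⟨k, hk⟩ := h.2
        rw [hA'0, hD1, hD1] at hk
        exact hk Iff.rfl
      simp_rw [e]
      simp
    · simp only [hA's]; exact hS j
  · refine le_trans (Nat.mul_le_mul_left _ (card_le_card fun x hx => ?_)) hNr
    rw [mem_filter] at hx ⊢
    refine ⟨hx.1, hx.2.1, fun ⟨kv, hkv, hnear⟩ => hx.2.2 ⟨Fin.cons ⟨0, by omega⟩ kv, ?_, fun i hi => ?_⟩⟩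
    · refine Fin.cases ?_ (fun j => ?_)
      · rw [Fin.cons_zero, hA'0, hD1]
      · rw [Fin.cons_succ, hA's]; exact hkv j
    · obtain ⟨j, hj⟩ := hnear i hi
      exact ⟨j.succ, by rw [Fin.cons_succ]; exact hj⟩

/-- hence `MAnchorable` is monotone in `m`. -/
theorem mAnchorable_mono_m (hN : 1 ≤ N) {m m' r c : ℕ} (hm : m ≤ m') {P : Fin N → CubeFn (ZMod 3) N}
    (h : MAnchorable m r c P) : MAnchorable m' r c P := by
  obtain ⟨d, rfl⟩ := Nat.exists_eq_add_of_le hm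
  induction d with
  | zero => exact h
  | succ d ih => exact mAnchorable_succ hN (ih (by omega))


end Summit.QuantumAdvantage.QuantumAdvantage.Theorems.AnchorDial

end
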